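import Summits.CriticalPhenomena.CardyFormulaZ2.Theorems.CardySusyWardParafermionFamiliesToSLESixTouchLowerBoundH
import Literature.Topology.PlaneTopology.JordanCurveProofs

/-!
# Touch lower bound on diagonal free walls (stub `stub_touchLowerBound`, reshape r2, of the line
# `exact-potential-schwarz-christoffel`, crux stmt-CriticalPhenomena-10814), I: the deterministic gluing

Helper file: the `ω`-wise heart of the GLUING half of `stub_touchLowerBound`. Setting: Dobrushin data `E` on
`(P.carrier, δ)` whose discrete arcs cover the discrete boundary; tube data `a', r, s, N, c` of
`exists_chainData_of_mem` (chain of centres from `c 0` to near the boundary point `a'` of the wired arc); at mesh `δ`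
the sites over the tube are in the bulk `Ω_δ` and the sites over the tube and over `B̄(a', r)` are off the discrete
free arc `zdArcB`; scales `m` (chain), `m₀` (a big circuit around `c 0`) and `L` (anchoring circuit around `a'`).

* `exists_exit_near`: the anchoring step of `BoxCrossingLowerBound.exists_reachable_discreteArc` with the Jordan
  curve theorem discharged (`JordanCurveTheorem_holds`) and the distance of the exit vertex to `a'` kept;
* `reachable_zdArcA_of_chain` (**the deterministic heart**): if `ω` has the chain events (open circuits of `A(2m)`
  around the centres, open long-way crossings of the `20m × m` rectangles between them), an open circuit of `A(L)`
  around `a'`, an open circuit of `A(2m₀)` around `c 0`, and an open path inside a region `R` of pairwise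
  `Ω_δ`-adjacent sites off `zdArcB` from a site `x` outside the big circuit to a site `z` inside it, then `x` is
  joined to a site of the discrete WIRED arc `zdArcA` by open edges of the completed configuration
  `E.bcBondConfig ω`. Proof: restrict `ω` to the edges off `zdArcB` (the events survive, their regions being off
  `zdArcB`); the chain cluster (`exists_chainCluster`) of the restricted configuration joins a point inside the big
  circuit to a point near `a'`, so it meets the big circuit, which the arm meets too (`EnclosesPoint`); near `a'` the
  cluster is glued to the anchoring circuit, which leaves the domain through a vertex of the discrete boundary
  (`exists_exit_of_encloses`) within `r` of `a'`, hence off `zdArcB`, hence on `zdArcA`; restricted-open edges of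
  `Ω_δ` and open edges inside `R` are open in `E.bcBondConfig ω`.
(buildfix 2026-08-20: comment-only re-land to re-enqueue the module build after its blocking imports were repaired; no declaration changed.)
-/

noncomputable section

namespace Summit.CriticalPhenomena.CardyFormulaZ2.Theorems.ParafermionFamiliesToSLESix.TouchLowerBound

open Set Metric Complex Filter MeasureTheory
open scoped Topology
open Literature.Probability.LatticeModels Literature.Probability.Percolation
open Literature.Probability.RandomPlanarGeometry
open Literature.Topology.PlaneTopology (JordanCurveTheorem_holds)

/-! ## Anchoring at the wired arc -/

-- adapted from `Literature/Probability/Percolation/BoxCrossingLowerBound.lean` (`exists_reachable_discreteArc`)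
/-- **Anchoring a cluster at a boundary point.** Let `a'` be a frontier point of the marked domain `P`; let
`ω ⊆ E(ℤ²)` contain an open circuit of `u + A(L)` around `u = nearestSite δ a'` with `3√2 L δ + 3δ < r`, `L ≥ 1`;
and let `D ⊆ E(ℤ²)` be an edge set whose vertices lie in the discrete domain, whose trace is preconnected and
joins a point within `(L + 1) δ` of `δ u` to a point farther than `3√2 L δ`. Then some vertex `j` of `D` is joined
inside `Ω_δ` by an `ω`-open path to a vertex `x` of the discrete boundary with `dist (δ x) a' + 2δ < r` (Jordan
curve theorem: the exterior of `P` is connected, unbounded and accumulates at `a'`). [cite: Grimmett2018, §5.7] -/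
theorem exists_exit_near {n : ℕ} [NeZero n] (P : MarkedDomain n) {a' : ℂ} {r : ℝ} (ha' : a' ∈ frontier P.carrier)
    {δ : ℝ} (hδ : 0 < δ) {ω : BondConfig (Site 2)} {L : ℕ} (hL : 1 ≤ L)
    (hLr : 3 * Real.sqrt 2 * L * δ + 3 * δ < r)
    (hA : ω ∈ openCircuitAroundAt (nearestSite δ a') L)
    {D : Set (Sym2 (Site 2))} (hDE : ∀ e ∈ D, e ∈ (zdGraph 2).edgeSet)
    (hDdom : ∀ x ∈ edgeVerts D, x ∈ meshDomain P.carrier δ)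
    (hDpre : IsPreconnected (⋃ e ∈ D, edgeTrace e))
    {p q : ℂ} (hp : p ∈ ⋃ e ∈ D, edgeTrace e) (hq : q ∈ ⋃ e ∈ D, edgeTrace e)
    (hpn : dist (meshScale δ p) (meshPoint δ (nearestSite δ a')) < ((L : ℝ) + 1) * δ)
    (hqn : 3 * Real.sqrt 2 * L * δ < dist (meshScale δ q) (meshPoint δ (nearestSite δ a'))) :
    ∃ j x : Site 2, j ∈ edgeVerts D ∧ x ∈ meshBoundary P.carrier δ ∧ dist (meshPoint δ x) a' + 2 * δ < r ∧
      (openGraph ω ⊓ discreteDomainGraph P.carrier δ).Reachable j x := by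
  set u := nearestSite δ a' with hu
  obtain ⟨a, W, hWc, hs, hopen, henc⟩ := hA
  -- the trace of `D` meets the circuit at a common vertex `j`
  have hTpre : IsPreconnected (meshScale δ '' ⋃ e ∈ D, edgeTrace e) :=
    hDpre.image _ (meshScale δ).continuous_of_finiteDimensional.continuousOn
  obtain ⟨j, hjD, hjW⟩ := exists_mem_edgeVerts_of_inter_meshTrace_nonempty hδ.ne' hDE
    (henc.inter_meshTrace_nonempty hδ hs hTpre (mem_image_of_mem _ hp) hpn (mem_image_of_mem _ hq) hqn)
  -- the exterior near `a'`
  obtain ⟨hEc, -, hEb⟩ := P.exterior_of_JCT JordanCurveTheorem_holds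
  have hua : dist a' (meshPoint δ u) ≤ δ := by
    rw [dist_comm]; exact dist_meshPoint_nearestSite_le hδ a'
  obtain ⟨e₁, he₁, he₁a⟩ : ∃ e₁ ∈ (closure P.carrier)ᶜ, dist e₁ a' < δ := by
    have := P.frontier_subset_closure_exterior JordanCurveTheorem_holds ha'
    obtain ⟨e₁, he₁, hd⟩ := Metric.mem_closure_iff.1 this δ hδ
    exact ⟨e₁, he₁, by rwa [dist_comm]⟩
  have he₁u : dist e₁ (meshPoint δ u) < ((L : ℝ) + 1) * δ := by
    have hL' : (1 : ℝ) ≤ L := by exact_mod_cast hL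
    calc dist e₁ (meshPoint δ u) ≤ dist e₁ a' + dist a' (meshPoint δ u) := dist_triangle _ _ _
      _ < δ + δ := by linarith
      _ ≤ ((L : ℝ) + 1) * δ := by nlinarith
  obtain ⟨e₂, he₂, he₂u⟩ : ∃ e₂ ∈ (closure P.carrier)ᶜ, 3 * Real.sqrt 2 * L * δ < dist e₂ (meshPoint δ u) := by
    by_contra! h
    exact hEb ((isBounded_iff_subset_closedBall (meshPoint δ u)).2 ⟨_, fun z hz => h z hz⟩)
  -- the exit
  obtain ⟨x, y, hxW, hxb, -, hreach, -⟩ := exists_exit_of_encloses hδ hs hopen henc hjW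
    (hDdom j hjD) hEc.isPreconnected Subset.rfl he₁ he₂ he₁u he₂u
  refine ⟨j, x, hjD, hxb, ?_, hreach⟩
  have hxu : dist (meshPoint δ x) (meshPoint δ u) ≤ 3 * Real.sqrt 2 * L * δ :=
    dist_meshPoint_le_of_mem_support hδ hWc.not_nil hs hxW
  calc dist (meshPoint δ x) a' + 2 * δ
      ≤ dist (meshPoint δ x) (meshPoint δ u) + dist (meshPoint δ u) a' + 2 * δ := by
        linarith [dist_triangle (meshPoint δ x) (meshPoint δ u) a']
    _ ≤ 3 * Real.sqrt 2 * L * δ + δ + 2 * δ := by rw [dist_comm (meshPoint δ u)]; linarith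
    _ < r := by linarith

/-! ## The deterministic heart -/

/-- `2m + 1 ≤ 3 √2 (2m)` for `m ≥ 1`. [folklore] -/
theorem two_mul_add_one_le {m : ℕ} (hm : 1 ≤ m) : ((2 * m : ℕ) : ℝ) + 1 ≤ 3 * Real.sqrt 2 * ((2 * m : ℕ) : ℝ) := by
  have hm' : (1 : ℝ) ≤ m := by exact_mod_cast hm
  have h2 := Real.one_lt_sqrt_two
  push_cast
  nlinarith

/-- **The deterministic heart of the gluing** (see the module docstring). [cite: Grimmett2018, §5.7] -/
theorem reachable_zdArcA_of_chain (P : DobrushinDomain) {E : DiscreteDobrushin} {δ : ℝ}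
    (hEΩ : E.Ω = P.carrier) (hEδ : E.δ = δ) (hadm : E.zdBoundary ⊆ E.zdArcA ∪ E.zdArcB)
    {a' : ℂ} {r s : ℝ} {N : ℕ} {c : ℕ → ℂ} (hsr : s ≤ r / 40) (ha' : a' ∈ frontier P.carrier)
    (hac : 10 * r ≤ dist a' (c 0)) (hcN : dist (c N) a' < r / 40)
    (hstep : ∀ k < N, dist (c k) (c (k + 1)) ≤ s / 100) (hball : ∀ k ≤ N, closedBall (c k) s ⊆ P.carrier)
    (hδ : 0 < δ) (hδs : δ ≤ s / 200)
    (hbulk : ∀ x : Site 2, (∃ k ≤ N, dist (meshPoint δ x) (c k) ≤ s / 2) → x ∈ meshDomain P.carrier δ)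
    (hfarB : ∀ x : Site 2, ((∃ k ≤ N, dist (meshPoint δ x) (c k) ≤ s / 2) ∨ dist (meshPoint δ x) a' ≤ r) →
      x ∉ E.zdArcB)
    {m m₀ L : ℕ} (hm : 1 ≤ m) (hmw : (m : ℝ) * δ ≤ s / 40) (hmw' : s / 100 + 2 * δ ≤ m * δ)
    (hm₀ : 1 ≤ m₀) (hmm₀ : 9 * ((m : ℝ) * δ) < ((2 * m₀ : ℕ) : ℝ) * δ)
    (hm₀far : 9 * ((m₀ : ℝ) * δ) + r / 20 + 2 * δ ≤ dist a' (c 0))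
    (hL : 1 ≤ L) (hLr : (L : ℝ) * δ ≤ r / 20) (hLr' : r / 20 < (L + 1) * δ)
    {ω : BondConfig (Site 2)} (hω : ω ⊆ (zdGraph 2).edgeSet)
    (hA₁ : ∀ k ≤ N, ω ∈ openCircuitAroundAt (nearestSite δ (c k)) (2 * m))
    (hA₂ : ∀ k < N, ω ∈ lrCrossingAt (nearestSite δ (c k) - ![(10 * m : ℤ), 0]) (20 * m) m)
    (hA₃ : ω ∈ openCircuitAroundAt (nearestSite δ a') L)
    (hA₀ : ω ∈ openCircuitAroundAt (nearestSite δ (c 0)) (2 * m₀))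
    {R : Set (Site 2)} (hRadj : ∀ v ∈ R, ∀ u ∈ R, (zdGraph 2).Adj v u → (discreteDomainGraph E.Ω E.δ).Adj v u)
    (hRB : ∀ v ∈ R, v ∉ E.zdArcB)
    (hR₀ : ∀ y : Site 2, dist (meshPoint δ y) (meshPoint δ (nearestSite δ (c 0))) ≤
      3 * Real.sqrt 2 * ((2 * m₀ : ℕ) : ℝ) * δ → y ∈ R)
    {x z : Site 2} (hxz : ω ∈ openConnIn R x z)
    (hzin : dist (meshPoint δ z) (meshPoint δ (nearestSite δ (c 0))) < (((2 * m₀ : ℕ) : ℝ) + 1) * δ)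
    (hxout : 3 * Real.sqrt 2 * ((2 * m₀ : ℕ) : ℝ) * δ < dist (meshPoint δ x) (meshPoint δ (nearestSite δ (c 0)))) :
    ∃ a ∈ E.zdArcA, (openGraph (E.bcBondConfig ω)).Reachable x a := by
  classical
  -- the restricted configuration
  set ω' : BondConfig (Site 2) := {e | e ∈ ω ∧ ∀ y ∈ e, y ∉ E.zdArcB} with hω'
  have hω'ω : ω' ⊆ ω := fun _ h => h.1
  have hω'E : ω' ⊆ (zdGraph 2).edgeSet := hω'ω.trans hω
  set v : ℕ → Site 2 := fun k => nearestSite δ (c k) with hv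
  have hvc : ∀ k, dist (meshPoint δ (v k)) (c k) ≤ δ := fun k => dist_meshPoint_nearestSite_le hδ _
  have hr0 : 0 < r := by
    have := dist_nonneg (x := c N) (y := a'); linarith
  have hua : dist a' (meshPoint δ (nearestSite δ a')) ≤ δ := by
    rw [dist_comm]; exact dist_meshPoint_nearestSite_le hδ _
  have hL3 := three_sqrt_two_mul_le hδ.le hLr
  have h92 : 3 * Real.sqrt 2 * ((2 * m : ℕ) : ℝ) * δ ≤ 9 * ((m : ℝ) * δ) := three_sqrt_two_two_mul_le hδ.le
  have h92₀ : 3 * Real.sqrt 2 * ((2 * m₀ : ℕ) : ℝ) * δ ≤ 9 * ((m₀ : ℝ) * δ) := three_sqrt_two_two_mul_le hδ.le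
  -- the events survive the restriction
  have hA₁' : ∀ k ≤ N, ω' ∈ openCircuitAroundAt (v k) (2 * m) := fun k hk =>
    mem_openCircuitAroundAt_restrict hδ (fun y hy => hfarB y (Or.inl ⟨k, hk, by
      linarith [dist_triangle (meshPoint δ y) (meshPoint δ (v k)) (c k), hvc k]⟩)) (hA₁ k hk)
  have hA₂' : ∀ k < N, ω' ∈ lrCrossingAt (v k - ![(10 * m : ℤ), 0]) (20 * m) m := by
    intro k hk
    refine mem_lrCrossingAt_restrict (fun y h1 h2 h3 h4 => hfarB y (Or.inl ⟨k, hk.le, ?_⟩)) (hA₂ k hk)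
    have hu0 : (v k - ![(10 * m : ℤ), 0]) 0 = v k 0 - 10 * m := by simp
    have hu1 : (v k - ![(10 * m : ℤ), 0]) 1 = v k 1 := by simp
    rw [hu0] at h1 h2
    rw [hu1] at h3 h4
    have hd := dist_meshPoint_le_of_abs_le hδ.le (x := y) (y := v k) (M₀ := 10 * m) (M₁ := m)
      (by rw [abs_le]; omega) (by rw [abs_le]; omega)
    push_cast at hd
    linarith [dist_triangle (meshPoint δ y) (meshPoint δ (v k)) (c k), hvc k]
  have hA₃' : ω' ∈ openCircuitAroundAt (nearestSite δ a') L :=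
    mem_openCircuitAroundAt_restrict hδ (fun y hy => hfarB y (Or.inr (by
      linarith [dist_triangle (meshPoint δ y) (meshPoint δ (nearestSite δ a')) a',
        dist_comm a' (meshPoint δ (nearestSite δ a'))]))) hA₃
  -- the chain cluster of the restricted configuration
  have hvstep : ∀ k < N, |v (k + 1) 0 - v k 0| ≤ m ∧ |v (k + 1) 1 - v k 1| ≤ m := by
    intro k hk
    have h : dist (c (k + 1)) (c k) + 2 * δ ≤ m * δ := by
      rw [dist_comm]; linarith [hstep k hk]
    exact ⟨abs_nearestSite_sub_le hδ h 0, abs_nearestSite_sub_le hδ h 1⟩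
  obtain ⟨D, hD⟩ := exists_chainCluster hω'E hm v N hvstep hA₁' hA₂'
  have hnear : ∀ q ∈ ⋃ e ∈ D, edgeTrace e, ∃ k ≤ N, dist (meshScale δ q) (c k) ≤ s / 2 := by
    intro q hq
    obtain ⟨e, he, hqe⟩ := mem_iUnion₂.1 hq
    obtain ⟨k, hk, hek⟩ := hD.near e he
    refine ⟨k, hk, ?_⟩
    have h1 : dist (meshScale δ q) (meshPoint δ (v k)) ≤ 11 * (m * δ) := by
      rw [dist_meshScale_meshPoint hδ.le]
      have := hek q hqe
      nlinarith
    linarith [dist_triangle (meshScale δ q) (meshPoint δ (v k)) (c k), hvc k]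
  have hDdom : ∀ y ∈ edgeVerts D, y ∈ meshDomain P.carrier δ := by
    intro y hy
    obtain ⟨q, hq, hqy⟩ := meshPoint_mem_image_of_mem_edgeVerts (δ := δ) hy
    obtain ⟨k, hk, hd⟩ := hnear q hq
    exact hbulk y ⟨k, hk, by rwa [hqy] at hd⟩
  have hDseg : ∀ y y', s(y, y') ∈ D → segment ℝ (meshPoint δ y) (meshPoint δ y') ⊆ P.carrier := by
    intro y y' hyy'
    rw [segment_meshPoint_eq_image]
    rintro _ ⟨q, hq, rfl⟩
    obtain ⟨k, hk, hd⟩ := hnear q (mem_biUnion hyy' hq)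
    exact hball k hk (mem_closedBall.2 (by linarith))
  have hle : SimpleGraph.fromEdgeSet D ≤ openGraph ω' ⊓ discreteDomainGraph P.carrier δ := by
    intro y y' hyy'
    rw [SimpleGraph.fromEdgeSet_adj] at hyy'
    have hadj : (zdGraph 2).Adj y y' := hD.mem_edgeSet _ hyy'.1
    refine open_inf_discreteDomainGraph_adj_iff.2 ⟨hD.subset hyy'.1, ?_, ?_, ?_⟩
    · exact meshGraph_adj_iff.2 ⟨hadj, (hDseg y y' hyy'.1).trans subset_closure⟩
    · exact hDdom y ⟨_, hyy'.1, Sym2.mem_mk_left _ _⟩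
    · exact hDdom y' ⟨_, hyy'.1, Sym2.mem_mk_right _ _⟩
  have hG : ∀ y ∈ edgeVerts D, ∀ y' ∈ edgeVerts D,
      (openGraph ω' ⊓ discreteDomainGraph P.carrier δ).Reachable y y' :=
    fun y hy y' hy' => (hD.reachable y hy y' hy').mono hle
  -- restricted-open edges of `Ω_δ` are open in the completed configuration
  have hbc : openGraph ω' ⊓ discreteDomainGraph P.carrier δ ≤ openGraph (E.bcBondConfig ω) := by
    intro y y' hyy'
    rw [SimpleGraph.inf_adj, openGraph_adj] at hyy'
    obtain ⟨⟨hmem, hne⟩, hadj⟩ := hyy'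
    rw [openGraph_adj]
    refine ⟨E.mem_bcBondConfig_iff.2 ⟨?_, Or.inr ⟨hmem.1, hmem.2⟩⟩, hne⟩
    rw [SimpleGraph.mem_edgeSet, hEΩ, hEδ]
    exact hadj
  -- the end circuits of the chain and the big circuit
  obtain ⟨a₀, w₀, hc₀, hs₀, henc₀, hD₀⟩ := hD.first
  obtain ⟨a₁, w₁, hc₁, hs₁, henc₁, hD₁⟩ := hD.last
  obtain ⟨b₀, W₀, hWc, hWs, hWo, hWenc⟩ := hA₀
  have hp : Site.toComplex a₁ ∈ ⋃ e ∈ D, edgeTrace e :=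
    walkTrace_subset_biUnion hD₁ (toComplex_start_mem_walkTrace hc₁.not_nil)
  have hq : Site.toComplex a₀ ∈ ⋃ e ∈ D, edgeTrace e :=
    walkTrace_subset_biUnion hD₀ (toComplex_start_mem_walkTrace hc₀.not_nil)
  have hd₀ : dist (meshPoint δ a₀) (meshPoint δ (v 0)) ≤ 9 * (m * δ) :=
    (dist_meshPoint_le_of_mem_support hδ hc₀.not_nil hs₀ w₀.start_mem_support).trans h92
  have hd₁ : dist (meshPoint δ a₁) (c N) ≤ 9 * (m * δ) + δ := by
    have h1 : dist (meshPoint δ a₁) (meshPoint δ (v N)) ≤ 3 * Real.sqrt 2 * ((2 * m : ℕ) : ℝ) * δ :=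
      dist_meshPoint_le_of_mem_support hδ hc₁.not_nil hs₁ w₁.start_mem_support
    linarith [dist_triangle (meshPoint δ a₁) (meshPoint δ (v N)) (c N), hvc N]
  have hd₁a : dist (meshPoint δ a₁) a' < r / 20 - δ := by
    linarith [dist_triangle (meshPoint δ a₁) (c N) a']
  -- (1) the cluster crosses the big circuit: a common vertex `j₂`
  have hTpre : IsPreconnected (meshScale δ '' ⋃ e ∈ D, edgeTrace e) :=
    hD.isPreconnected.image _ (meshScale δ).continuous_of_finiteDimensional.continuousOn
  obtain ⟨j₂, hj₂D, hj₂W⟩ := exists_mem_edgeVerts_of_inter_meshTrace_nonempty hδ.ne' hD.mem_edgeSet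
    (hWenc.inter_meshTrace_nonempty hδ hWs hTpre (mem_image_of_mem _ hq)
      (by rw [← meshPoint_eq_meshScale]; linarith)
      (mem_image_of_mem _ hp)
      (by
        rw [← meshPoint_eq_meshScale]
        linarith [dist_triangle a' (meshPoint δ a₁) (c 0), dist_comm a' (meshPoint δ a₁),
          dist_triangle (meshPoint δ a₁) (meshPoint δ (v 0)) (c 0), hvc 0]))
  -- (2) the arm crosses the big circuit: a common vertex `j`
  obtain ⟨T, hTR, hTω⟩ := exists_walk_of_mem_openConnIn hω hxz
  have hTn : ¬ T.Nil := by
    rintro ⟨⟩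
    linarith [mul_le_mul_of_nonneg_right (two_mul_add_one_le hm₀) hδ.le]
  obtain ⟨j, hjT, hjW⟩ := exists_mem_support_of_meshTrace_inter_nonempty hδ.ne'
    (hWenc.inter_meshTrace_nonempty hδ hWs (isPreconnected_meshTrace δ T)
      (meshPoint_mem_meshTrace_of_mem_support hTn T.end_mem_support) hzin
      (meshPoint_mem_meshTrace_of_mem_support hTn T.start_mem_support) hxout)
  -- (3) `x ↔ j ↔ j₂` in the completed configuration (inside `R`)
  have hWR : ∀ y ∈ W₀.support, y ∈ R := fun y hy =>
    hR₀ y (dist_meshPoint_le_of_mem_support hδ hWc.not_nil hWs hy)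
  have hxj : ω ∈ openConnIn R x j := mem_openConnIn_of_mem_support T hTR hTω hjT
  have hjj₂ : ω ∈ openConnIn R j j₂ :=
    PlanarDuality.openConnIn_trans (by rw [openConnIn_comm]; exact mem_openConnIn_of_mem_support W₀ hWR hWo hjW)
      (mem_openConnIn_of_mem_support W₀ hWR hWo hj₂W)
  have hreach₁ : (openGraph (E.bcBondConfig ω)).Reachable x j₂ :=
    reachable_bc_of_openConnIn hω hRadj hRB (PlanarDuality.openConnIn_trans hxj hjj₂)
  -- (4) anchor the cluster at `a'`
  have hLr3 : 3 * Real.sqrt 2 * L * δ + 3 * δ < r := by linarith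
  obtain ⟨j', x', hj', hx'b, hx'd, hreach'⟩ := exists_exit_near P ha' hδ hL hLr3 hA₃' hD.mem_edgeSet hDdom
    hD.isPreconnected hp hq
    (by
      rw [← meshPoint_eq_meshScale]
      linarith [dist_triangle (meshPoint δ a₁) a' (meshPoint δ (nearestSite δ a'))])
    (by
      rw [← meshPoint_eq_meshScale]
      linarith [dist_triangle a' (meshPoint δ (nearestSite δ a')) (c 0),
        dist_triangle (meshPoint δ (nearestSite δ a')) (meshPoint δ a₀) (c 0),
        dist_triangle (meshPoint δ a₀) (meshPoint δ (v 0)) (c 0), hvc 0,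
        dist_comm (meshPoint δ (nearestSite δ a')) (meshPoint δ a₀), hmw, hsr])
  have hreach₂ : (openGraph (E.bcBondConfig ω)).Reachable j₂ x' := ((hG j₂ hj₂D j' hj').trans hreach').mono hbc
  have hx'A : x' ∈ E.zdArcA := by
    have hx'bd : x' ∈ E.zdBoundary := E.meshBoundary_subset_zdBoundary (by rw [hEΩ, hEδ]; exact hx'b)
    have hx'B : x' ∉ E.zdArcB := hfarB x' (Or.inr (by linarith))
    exact (hadm hx'bd).resolve_right hx'B
  exact ⟨x', hx'A, hreach₁.trans hreach₂⟩

end Summit.CriticalPhenomena.CardyFormulaZ2.Theorems.ParafermionFamiliesToSLESix.TouchLowerBound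

end
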